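/-
Copyright (c) 2026 the pub-hodgecm-mathlib formalisation cell (harness21).  Prover seat hodgecm-mathlib-F0P3-p01 (g32), Track A «(D-RAM) FOUR-FRAME», unit U2H, census leaf
(ρ2b′-X) — T5b «toric level census, type RamK»: the index bookkeeping of a norm map whose image has index two.  2026-09-04.
-/
import Mathlib.GroupTheory.Index
import HarnessLib

/-!
# Pulling a subgroup back along a homomorphism whose image has index two: `[U : U ∩ f⁻¹V] = [A : V] ∕ 2` if `V ≤ f(U)`, `= [A : V]` otherwise
(Serre, *Local Fields* Ch. V §3 Cor. 3 — the norm group of a ramified quadratic extension has index two in the units; Flicker 1998 p. 84 (index bookkeeping of the orders))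

Topic `NumberTheory/LocalFields`; namespace `Literature.NumberTheory.LocalFields.QuadraticOrder` (the coset bookkeeping of ★ `QuadraticOrderLatticeClasses` §4, continued).  THEOREMS
ONLY (no definition, no instance, no notation, no named fact, no `sorry`); kernel lane `--supports stmt-HodgeConjecture-24833` (count-neutral).  Cell `pub/hodgecm-mathlib` (D-0151),
crux H413, Track A, unit U2H, census leaf (ρ2b′-X): in the type-RamK toric census (hodgecm-mathlib-F0P3-p01 (g32) T5b memo §2) the depth histogram of the hermitian norms
`ωΘω` is governed by the index `I(c) = [U_M : B_c]`, `B_c = U_M ∩ N⁻¹(Ṽ_c)`, where the norm `N : ω ↦ ωΘω` maps the units `U_M` onto a subgroup of INDEX TWO of the `Θ`-fixed units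
`Ũ` (`M∕K♮` ramified) and `Ṽ_c ≤ Ũ` has index `J(c)`.  THIS FILE is the abstract group theory of that situation (any groups, any hom `f`):
* `relIndex_comap_eq_div_two_of_le` — `V ≤ f(U)` ⇒ `[U : U ∩ f⁻¹V] = [A : V] ∕ 2` (and `2 ∣ [A : V]`);
* `relIndex_comap_eq_of_not_le` — `V ≰ f(U)` ⇒ `[U : U ∩ f⁻¹V] = [A : V]`;
* `relIndex_comap_eq_ite` — the two cases as one `if`.
(Mathlib letters: `H.relIndex K = [K : H ⊓ K]`; `Subgroup.relIndex_comap`, `relIndex_mul_relIndex`, `relIndex_inf_mul_relIndex`.)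
HONEST LABEL: HC_CM is proved only modulo the 7 printed citations (2 remaining named inputs: hLiu418 = stmt-HodgeConjecture-24832, h413 = stmt-HodgeConjecture-24833) until rung 0
closes; pure group theory, count-neutral.

## References
* [Serre1979] J.-P. Serre, *Local Fields*, GTM 67 (1979): Ch. V §3 Cor. 3 (the norm subgroup of a ramified quadratic extension has index two in the units).
* [Flicker1998UnitaryFL] Y. Z. Flicker, *Elementary proof of the fundamental lemma for a unitary group*, Canad. J. Math. 50 (1998): p. 84 (unit indices of the orders `R_E(j)`).
-/

set_option autoImplicit false

namespace Literature.NumberTheory.LocalFields.QuadraticOrder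

section IndexTwoPullback

variable {G G' : Type*} [Group G] [Group G'] (f : G →* G') {U : Subgroup G} {A V : Subgroup G'}

/-- **`V ≤ f(U)` ⇒ `[U : U ∩ f⁻¹V]·2 = [A : V]`**: pull back along `f` (`Subgroup.relIndex_comap`) and multiply indices up the chain `V ≤ f(U) ≤ A` with `[A : f(U)] = 2`.
[cite: Serre1979, Ch. V §3 Cor. 3] -/
theorem relIndex_comap_mul_two_of_le (hUA : U.map f ≤ A) (h2 : (U.map f).relIndex A = 2) (hV : V ≤ U.map f) :
    (V.comap f).relIndex U * 2 = V.relIndex A := by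
  rw [Subgroup.relIndex_comap, ← h2]
  exact Subgroup.relIndex_mul_relIndex V (U.map f) A hV hUA

/-- **`V ≤ f(U)` ⇒ `[U : U ∩ f⁻¹V] = [A : V] ∕ 2`** (and `[A : V]` is even). [cite: Serre1979, Ch. V §3 Cor. 3] [cite: Flicker1998UnitaryFL, p. 84] -/
theorem relIndex_comap_eq_div_two_of_le (hUA : U.map f ≤ A) (h2 : (U.map f).relIndex A = 2) (hV : V ≤ U.map f) :
    (V.comap f).relIndex U = V.relIndex A / 2 ∧ 2 ∣ V.relIndex A := by
  have h := relIndex_comap_mul_two_of_le f hUA h2 hV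
  exact ⟨by rw [← h, Nat.mul_div_cancel _ two_pos], ⟨(V.comap f).relIndex U, by rw [← h, mul_comm]⟩⟩

/-- **`V ≰ f(U)` (with `V ≤ A`) ⇒ `[U : U ∩ f⁻¹V] = [A : V]`**: `[V : V ∩ f(U)]` injects into `[A : f(U)] = 2` and is not `1`, so it is `2`; then
`[f(U) : V ∩ f(U)]·2 = [V : V ∩ f(U)]·[A : V] = 2·[A : V]`. [cite: Serre1979, Ch. V §3 Cor. 3] [cite: Flicker1998UnitaryFL, p. 84] -/
theorem relIndex_comap_eq_of_not_le (hUA : U.map f ≤ A) (h2 : (U.map f).relIndex A = 2) (hVA : V ≤ A) (hV : ¬ V ≤ U.map f) :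
    (V.comap f).relIndex U = V.relIndex A := by
  -- `[V : V ∩ f(U)] = 2`
  have hNA0 : (U.map f).relIndex A ≠ 0 := by rw [h2]; exact two_ne_zero
  have hNV0 : (U.map f).relIndex V ≠ 0 := fun h0 => hNA0 (Subgroup.relIndex_eq_zero_of_le_right hVA h0)
  have hNVle : (U.map f).relIndex V ≤ 2 := h2 ▸ Subgroup.relIndex_le_of_le_right hVA hNA0
  have hNV1 : (U.map f).relIndex V ≠ 1 := fun h1 => hV (Subgroup.relIndex_eq_one.1 h1)
  have hNV2 : (U.map f).relIndex V = 2 := by omega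
  -- index bookkeeping
  have h1 : V.relIndex (U.map f ⊓ A) * (U.map f).relIndex A = (V ⊓ U.map f).relIndex A := Subgroup.relIndex_inf_mul_relIndex V (U.map f) A
  rw [inf_eq_left.2 hUA, h2] at h1
  have h3 : (V ⊓ U.map f).relIndex V * V.relIndex A = (V ⊓ U.map f).relIndex A :=
    Subgroup.relIndex_mul_relIndex (V ⊓ U.map f) V A inf_le_left hVA
  rw [Subgroup.inf_relIndex_left, hNV2] at h3
  rw [Subgroup.relIndex_comap]
  -- `V.relIndex f(U) * 2 = 2 * V.relIndex A`
  have key : V.relIndex (U.map f) * 2 = 2 * V.relIndex A := by rw [h1, ← h3]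
  omega

/-- **THE TWO CASES AS ONE `if`**: with `f(U) ≤ A` of index `2` and `V ≤ A`, `[U : U ∩ f⁻¹V] = if V ≤ f(U) then [A : V] ∕ 2 else [A : V]` — the shape `I(c) = J(c)∕2` above the
non-norm threshold and `J(c)` below it of the RamK toric census. [cite: Serre1979, Ch. V §3 Cor. 3] [cite: Flicker1998UnitaryFL, p. 84] -/
theorem relIndex_comap_eq_ite (hUA : U.map f ≤ A) (h2 : (U.map f).relIndex A = 2) (hVA : V ≤ A) [Decidable (V ≤ U.map f)] :
    (V.comap f).relIndex U = if V ≤ U.map f then V.relIndex A / 2 else V.relIndex A := by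
  split_ifs with hV
  · exact (relIndex_comap_eq_div_two_of_le f hUA h2 hV).1
  · exact relIndex_comap_eq_of_not_le f hUA h2 hVA hV

end IndexTwoPullback

end Literature.NumberTheory.LocalFields.QuadraticOrder
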